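import Mathlib
import Summits.Ventures.PercRepro.TriangleCapFourBelowAssemblyB

/-!
# PercRepro — FOUR BELOW THE DIAGONAL: THE CELLS `m = a (k − a) − 4` FOR `k ≥ 13`, MODULO THE ONE-TRIANGLE
RESIDUE (p3, gen 39; part 128)

**`four_below_diagonal_exact_k4m_of_thirteen_modulo`**: for `k ≥ 13`, `1 ≤ a`, `a + 4 ≤ k`, `m = a (k − a) − 4`
with `m, …, m + 3` not of the form `a′ (k − a′)`, the maximum of `2·Σ_v C(d(v), 2)` over the `K₄⁻`-free graphs on
`Fin k` with `m` edges is `m (k − 2) − 4 (k − 5)`, attained by `K_{a, k−a}` minus four edges at one vertex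
(`bipMinusStar k a 4`) — MODULO the one-triangle residue `hone` of `dense_stability_four_modulo_few_outer` (the
`K₄⁻`-free graphs on `Fin k` with `m` edges whose triangles all lie on one triangle, with every degree `≥ 2`, with
`10q + 2m + 28 < 8k` outer vertices and `q ≤ 4` or `m ≥ 3k`).  The arithmetic of the cells (`cell_arith_four`):
`2k ≤ a (k − a)` forces `3 ≤ a ≤ k − 3`, so `m ≥ 3k − 13`.  Axioms: standard.
-/

namespace PercRepro

namespace TriangleCap

namespace C047

open Finset

variable {V : Type*} [Fintype V] [DecidableEq V]

omit [Fintype V] [DecidableEq V] in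
/-- The arithmetic of the cells four below the diagonal: `2k ≤ a (k − a)` with `a ≤ k` forces `3 ≤ a ≤ k − 3`, so
`a (k − a) ≥ 3 (k − 3)`. -/
theorem cell_arith_four (k a : ℕ) (hak : a ≤ k) (hdense : 2 * k ≤ a * (k - a)) (hk : 10 ≤ k) :
    3 * (k - 3) ≤ a * (k - a) := by
  have ha3 : 3 ≤ a := by
    by_contra h
    push Not at h
    interval_cases a <;> omega
  have hak3 : a + 3 ≤ k := by
    by_contra h
    push Not at h
    obtain ⟨d, hd⟩ : ∃ d, k = a + d := ⟨k - a, by omega⟩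
    subst hd
    have : a + d - a = d := by omega
    rw [this] at hdense
    have hd2 : d ≤ 2 := by omega
    interval_cases d <;> omega
  obtain ⟨p, hp⟩ : ∃ p, a = p + 3 := ⟨a - 3, by omega⟩
  obtain ⟨q, hq⟩ : ∃ q, k = a + q + 3 := ⟨k - a - 3, by omega⟩
  subst hp
  subst hq
  have e1 : p + 3 + q + 3 - (p + 3) = q + 3 := by omega
  have e2 : p + 3 + q + 3 - 3 = p + q + 3 := by omega
  rw [e1, e2]
  nlinarith

/-- **FOUR BELOW THE DIAGONAL ON THE `K₄⁻`-FREE CLASS FOR `k ≥ 13`, MODULO THE ONE-TRIANGLE RESIDUE:** for `1 ≤ a`,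
`a + 4 ≤ k`, `m = a (k − a) − 4 ≥ 2k − 4` with `m, m + 1, m + 2, m + 3` not of the form `a′ (k − a′)`, the maximum of
`2·Σ_v C(d(v), 2)` over the `K₄⁻`-free graphs on `Fin k` with `m` edges is `m (k − 2) − 4 (k − 5)`, attained by
`K_{a, k−a}` minus four edges at one vertex — given the one-triangle residue `hone` for the graphs of the cell. -/
theorem four_below_diagonal_exact_k4m_of_thirteen_modulo (k a : ℕ) (hk : 13 ≤ k) (ha : 1 ≤ a) (hak : a + 4 ≤ k)
    (hdense : 2 * k ≤ a * (k - a) - 4 + 4)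
    (hm : ∀ a', a' ≤ k → a * (k - a) - 4 ≠ a' * (k - a') ∧ a * (k - a) - 3 ≠ a' * (k - a') ∧
      a * (k - a) - 2 ≠ a' * (k - a') ∧ a * (k - a) - 1 ≠ a' * (k - a'))
    (hone : ∀ (D : SimpleGraph (Fin k)) [DecidableRel D.Adj], K4mFree D → D.edgeFinset.card = a * (k - a) - 4 →
      ∀ u v w, D.Adj u v → D.Adj u w → D.Adj v w →
      (∀ a b c, D.Adj a b → D.Adj a c → D.Adj b c → a = u ∨ a = v ∨ a = w) → (∀ z, 2 ≤ deg D z) →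
      10 * ((({u, v, w} : Finset (Fin k))ᶜ).filter (fun z => degIn D {u, v, w} z = 0)).card +
        2 * D.edgeFinset.card + 28 < 8 * k →
      (((({u, v, w} : Finset (Fin k))ᶜ).filter (fun z => degIn D {u, v, w} z = 0)).card ≤ 4 ∨
        3 * k ≤ D.edgeFinset.card) →
      ∑ v, deg D v * deg D v + 4 * (k - 5) ≤ D.edgeFinset.card * k) :
    (∀ (D : SimpleGraph (Fin k)) [DecidableRel D.Adj], K4mFree D →
        D.edgeFinset.card = a * (k - a) - 4 →
        2 * cherries D + 4 * (k - 5) ≤ (a * (k - a) - 4) * (k - 2)) ∧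
      ∃ (D : SimpleGraph (Fin k)) (_ : DecidableRel D.Adj), K4mFree D ∧
        D.edgeFinset.card = a * (k - a) - 4 ∧ 2 * cherries D + 4 * (k - 5) = (a * (k - a) - 4) * (k - 2) := by
  have hka : 4 ≤ a * (k - a) := by
    obtain ⟨c, hc⟩ : ∃ c, k = a + 4 + c := ⟨k - a - 4, by omega⟩
    subst hc
    have : a + 4 + c - a = 4 + c := by omega
    rw [this]
    nlinarith
  have hcell := cell_arith_four k a (by omega) (by omega) (by omega)
  obtain ⟨m, hmm⟩ : ∃ m, a * (k - a) = m + 4 := ⟨a * (k - a) - 4, by omega⟩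
  have e1 : a * (k - a) - 4 = m := by omega
  have e2 : a * (k - a) - 3 = m + 1 := by omega
  have e3 : a * (k - a) - 2 = m + 2 := by omega
  have e4 : a * (k - a) - 1 = m + 3 := by omega
  rw [e1] at hdense hm hone ⊢
  rw [e2, e3, e4] at hm
  rw [hmm] at hcell
  constructor
  · intro D _ hK hD
    have hcard : Fintype.card (Fin k) = k := Fintype.card_fin k
    have hprod : ∀ a', a' ≤ Fintype.card (Fin k) → D.edgeFinset.card ≠ a' * (Fintype.card (Fin k) - a') ∧
        D.edgeFinset.card + 1 ≠ a' * (Fintype.card (Fin k) - a') ∧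
        D.edgeFinset.card + 2 ≠ a' * (Fintype.card (Fin k) - a') ∧
        D.edgeFinset.card + 3 ≠ a' * (Fintype.card (Fin k) - a') := by
      intro a' ha'
      rw [hcard] at ha' ⊢
      rw [hD]
      exact hm a' ha'
    have h1 := dense_stability_four_modulo_few_outer D hK (by rw [hcard]; exact hk) (by rw [hcard, hD]; omega)
      hprod (by
        intro u v w huv huw hvw hT hdeg hq hor
        rw [hcard] at hq hor ⊢
        exact hone D hK hD u v w huv huw hvw hT hdeg hq hor)
    have h2 := two_mul_cherries_add D
    have h3 := sum_deg_eq D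
    rw [hcard, hD] at h1
    rw [hD] at h3
    obtain ⟨k', hk'⟩ : ∃ k', k = k' + 5 := ⟨k - 5, by omega⟩
    subst hk'
    have e5 : k' + 5 - 5 = k' := by omega
    have e6 : k' + 5 - 2 = k' + 3 := by omega
    rw [e5] at h1 ⊢
    rw [e6]
    nlinarith
  · refine ⟨bipMinusStar k a 4, inferInstance, k4mFree_bipMinusStar k a 4, ?_, ?_⟩
    · have := card_edges_bipMinusStar k a 4 ha hak
      omega
    · have h := two_mul_cherries_bipMinusStar k a 4 ha hak (by omega)
      rw [hmm] at h
      obtain ⟨k', hk'⟩ : ∃ k', k = k' + 5 := ⟨k - 5, by omega⟩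
      subst hk'
      have e5 : k' + 5 - 5 = k' := by omega
      have e6 : k' + 5 - 2 = k' + 3 := by omega
      have e7 : 2 * (k' + 5) - 4 - 3 = 2 * k' + 3 := by omega
      rw [e6, e7] at h
      rw [e5, e6]
      nlinarith

end C047

end TriangleCap

end PercRepro
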